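import Literature.Analysis.SegalBargmann.SchwartzTensorSchurProjective
import Literature.Analysis.Distribution.SchwartzExternalProduct
import HarnessLib

/-!
# Sum stripping for projectively covariant operators on `𝓢((ι₁ ⊕ ι₂) → V)`: `M = A₁ ⊠̂ 1`

Topic `Analysis/SegalBargmann`; namespace `Literature.Analysis.SegalBargmann`.  Origin: `pub-hodgecm`, GR-construction
(kernel construction of [GelbartRogawski1991, Prop. 3.1.1]), GR-2's stub S4 (undoubling `U(𝕍) × 1 ⊂ U(𝕍 ⊕ −𝕍)`).
KERNEL MATHEMATICS ONLY: everything below is proved; no `def … : Prop` record, no cited hypothesis.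

The two-factor Schur lemma of `SchwartzTensorSchurProjective` COMPARES a block-covariant automorphism `M` of
`𝓢((ι₁ ⊕ ι₂) → V)` with GIVEN covariant automorphisms `A₁`, `A₂` of the factors.  When the second block is trivial
(`s₂ = id`, `χ₂ = 1`: the symplectic map is `g₁ ⊕ 1`) one does not need `A₁` as an input — it can be READ OFF `M`:

* §1 the Schwartz slice `sumSlice a₂ : 𝓢((ι₁ ⊕ ι₂) → V) →L 𝓢(ι₁ → V)`, `Ψ ↦ Ψ(·, a₂)` (Mathlib's `SchwartzMap.compCLM`
  along the affine isometric embedding `x₁ ↦ (x₁, a₂)`), its value on separate-variable products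
  (`sumSlice_piBoxTensor`: `(f ⊠ g)(·, a₂) = g(a₂) f`) and its equivariance for the Heisenberg operators of the first
  block (`sumSlice_rhoSD_elim_zero`);
* §2 the MAP form of the projective two-factor Schur lemma on transported carriers
  (`exists_smul_of_tensor_covariant_projD`: covariant `A₁`, `A₂` continuous linear MAPS ⇒ `A₁ f ⊠ A₂ g = c • M (f ⊠ g)`,
  transport of `eq_smul_of_tensor_covariant_proj`);
* §3 **`exists_sumStrip`**: if `M` is a continuous linear automorphism of `𝓢((ι₁ ⊕ ι₂) → V)` with
  `M ρ(P,Q) = blockChar χ₁ χ₂ (P,Q) • ρ(blockPhase s₁ s₂ (P,Q)) M`, `χ₁` nowhere zero, `s₂ = id` and `χ₂ = 1`, then there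
  is a continuous linear AUTOMORPHISM `A₁` of `𝓢(ι₁ → V)`, covariant over `(s₁, χ₁)`, with
  **`M (f ⊠ g) = A₁ f ⊠ g`** for all `f, g` (`⊠ = piBoxTensor`).  `A₁` is the normalised slice
  `f ↦ c⁻¹ (M (f ⊠ g₀))(·, a₂)`; its inverse is a slice of `M⁻¹`.

This is the archimedean half of the «sum-stripping» theorem for the adelic metaplectic group (an LF-continuous
implementer of `g₁ ⊕ 1` on `𝒮(𝔸^{ι₁ ⊕ ι₂})` is `(M₁ ⊠ 1)` with `(g₁, M₁)` an implementer on `𝒮(𝔸^{ι₁})`), the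
operator-level form of the functoriality `𝐫(s₁ ⊕ 1) = 𝐫(s₁) ⊗ 1` of Weil's metaplectic representation
[Weil1964, Chap. III n° 37–38; Folland1989, Prop. (1.43), §1.7].

## References

* [Folland1989] G. B. Folland, *Harmonic Analysis in Phase Space*, Princeton UP (1989), §1.4 Prop. (1.43), §1.7.
* [Weil1964] A. Weil, *Sur certains groupes d'opérateurs unitaires*, Acta Math. 111 (1964), n° 37–38.

## Provenance

LEAN-IN-TREE rule (2026-08-18), pub-hodgecm GR-construction, seat own-hyp34 ≡ GR-2 gen 2 (stub S4, undoubling).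
-/

set_option autoImplicit false

noncomputable section

open MeasureTheory Complex SchwartzMap Filter Topology
open scoped BigOperators Real

namespace Literature.Analysis.SegalBargmann

open Literature.Analysis.Distribution

local notation "SR" σ:max => (SchwartzMap (σ → ℝ) ℂ)
local notation "SD" D:max => (SchwartzMap D ℂ)

/-! ## §1  The Schwartz slice along the second block of variables -/

section Slice

variable {V : Type*} [NormedAddCommGroup V] [NormedSpace ℝ V] {ι₁ ι₂ : Type*} [Fintype ι₁] [Fintype ι₂]

/-- the affine embedding `x₁ ↦ (x₁, a₂)` of `ι₁ → V` into `(ι₁ ⊕ ι₂) → V`. [folklore] -/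
def sumEmb (a₂ : ι₂ → V) (x₁ : ι₁ → V) : ι₁ ⊕ ι₂ → V := Sum.elim x₁ a₂

omit [NormedAddCommGroup V] [NormedSpace ℝ V] [Fintype ι₁] [Fintype ι₂] in
/-- pointwise. [folklore] -/
@[simp] private theorem sumEmb_apply (a₂ : ι₂ → V) (x₁ : ι₁ → V) : sumEmb a₂ x₁ = Sum.elim x₁ a₂ := rfl

/-- the linear part `x₁ ↦ (x₁, 0)` of `sumEmb`. [folklore] -/
def sumEmbL : (ι₁ → V) →L[ℝ] (ι₁ ⊕ ι₂ → V) :=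
  ContinuousLinearMap.pi (Sum.elim (fun j : ι₁ => ContinuousLinearMap.proj (R := ℝ) (φ := fun _ : ι₁ => V) j)
    (fun _ : ι₂ => 0))

omit [Fintype ι₁] [Fintype ι₂] in
/-- pointwise. [folklore] -/
private theorem sumEmbL_apply (x₁ : ι₁ → V) : sumEmbL (ι₂ := ι₂) x₁ = Sum.elim x₁ (0 : ι₂ → V) := by
  funext i
  rw [sumEmbL, ContinuousLinearMap.pi_apply]
  rcases i with j | k
  · simp
  · simp

omit [Fintype ι₁] [Fintype ι₂] in
/-- `sumEmb a₂ = sumEmbL + const`. [folklore] -/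
private theorem sumEmb_eq_add (a₂ : ι₂ → V) :
    (sumEmb a₂ : (ι₁ → V) → ι₁ ⊕ ι₂ → V) =
      (fun x₁ => sumEmbL (ι₂ := ι₂) x₁) + fun _ => Sum.elim (0 : ι₁ → V) a₂ := by
  funext x₁
  rw [Pi.add_apply, sumEmbL_apply, sumEmb_apply]
  funext i
  rcases i with j | k <;> simp

/-- `sumEmb a₂` has temperate growth (affine). [folklore] -/
private theorem hasTemperateGrowth_sumEmb (a₂ : ι₂ → V) :
    Function.HasTemperateGrowth (sumEmb a₂ : (ι₁ → V) → ι₁ ⊕ ι₂ → V) := by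
  rw [sumEmb_eq_add]
  exact (sumEmbL (ι₁ := ι₁) (ι₂ := ι₂) (V := V)).hasTemperateGrowth.add (Function.HasTemperateGrowth.const _)

omit [NormedSpace ℝ V] in
/-- `‖x₁‖ ≤ ‖(x₁, a₂)‖` (sup norms). [folklore] -/
private theorem norm_le_norm_sumEmb (a₂ : ι₂ → V) (x₁ : ι₁ → V) : ‖x₁‖ ≤ ‖sumEmb a₂ x₁‖ := by
  rw [pi_norm_le_iff_of_nonneg (norm_nonneg _)]
  intro j
  exact norm_le_pi_norm (sumEmb a₂ x₁) (Sum.inl j)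

/-- **The Schwartz slice** `Ψ ↦ Ψ(·, a₂)`: `𝓢((ι₁ ⊕ ι₂) → V) →L[ℂ] 𝓢(ι₁ → V)`. [folklore] -/
def sumSlice (a₂ : ι₂ → V) : (SD (ι₁ ⊕ ι₂ → V)) →L[ℂ] SD (ι₁ → V) :=
  SchwartzMap.compCLM ℂ (hasTemperateGrowth_sumEmb a₂)
    ⟨1, 1, fun x₁ => by
      rw [one_mul, pow_one]
      exact (norm_le_norm_sumEmb a₂ x₁).trans (le_add_of_nonneg_left zero_le_one)⟩

/-- pointwise: `sumSlice a₂ Ψ x₁ = Ψ (x₁, a₂)` (restriction of a Schwartz function to an affine slice of the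
second group of variables). [cite: Folland1989, §1.7] -/
@[simp] theorem sumSlice_apply (a₂ : ι₂ → V) (Ψ : SD (ι₁ ⊕ ι₂ → V)) (x₁ : ι₁ → V) :
    sumSlice a₂ Ψ x₁ = Ψ (Sum.elim x₁ a₂) := rfl

/-- **slice of a separate-variables product**: `(f ⊠ g)(·, a₂) = g(a₂) • f`. [cite: Folland1989, §1.7] -/
theorem sumSlice_piBoxTensor (a₂ : ι₂ → V) (f : SD (ι₁ → V)) (g : SD (ι₂ → V)) :
    sumSlice a₂ (piBoxTensor f g) = g a₂ • f := by
  ext x₁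
  rw [sumSlice_apply, piBoxTensor_apply, Sum.elim_comp_inl, Sum.elim_comp_inr, smul_apply, smul_eq_mul,
    mul_comm]

/-- the external product with a fixed `g` IS `piBoxTensor` (`sumProdLeftCLM g f = f ⊠ g`). [folklore] -/
private theorem sumProdLeftCLM_apply_eq_piBoxTensor (g : SD (ι₂ → V)) (f : SD (ι₁ → V)) :
    SchwartzMap.sumProdLeftCLM g f = piBoxTensor f g := by
  ext x
  rfl

variable {τ : Type*} [Fintype τ] (b : Module.Basis τ ℝ V)

/-- coordinates of a two-block vector. [folklore] -/
private theorem sumCarrierEquiv_elim (y₁ : ι₁ → V) (y₂ : ι₂ → V) :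
    sumCarrierEquiv b ι₁ ι₂ (Sum.elim y₁ y₂) = Sum.elim (piCarrierEquiv b ι₁ y₁) (piCarrierEquiv b ι₂ y₂) := by
  funext i
  rcases i with ⟨j, t⟩ | ⟨k, t⟩
  · rw [sumCarrierEquiv_apply_inl, Sum.elim_inl, Sum.elim_inl, piCarrierEquiv_apply]
  · rw [sumCarrierEquiv_apply_inr, Sum.elim_inr, Sum.elim_inr, piCarrierEquiv_apply]

/-- inverse coordinates of a two-block vector. [folklore] -/
private theorem sumCarrierEquiv_symm_elim (p₁ : ι₁ × τ → ℝ) (p₂ : ι₂ × τ → ℝ) :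
    (sumCarrierEquiv b ι₁ ι₂).symm (Sum.elim p₁ p₂) =
      Sum.elim ((piCarrierEquiv b ι₁).symm p₁) ((piCarrierEquiv b ι₂).symm p₂) := by
  apply (sumCarrierEquiv b ι₁ ι₂).injective
  rw [ContinuousLinearEquiv.apply_symm_apply, sumCarrierEquiv_elim, ContinuousLinearEquiv.apply_symm_apply,
    ContinuousLinearEquiv.apply_symm_apply]

omit [Fintype τ] in
/-- `rhoMul 0 0 = 1`: the phase of `ρ(0, 0)` is trivial. [cite: Folland1989, (1.25)] -/
theorem rhoMul_zero_zero {σ : Type*} [Fintype σ] (x : σ → ℝ) : rhoMul (0 : σ → ℝ) 0 x = 1 := by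
  simp [rhoMul]

/-- `ρ(0, 0) = 1`. [cite: Folland1989, (1.25)] -/
theorem rhoSD_zero_zero_apply {D : Type*} [NormedAddCommGroup D] [NormedSpace ℝ D] {σ : Type*} [Fintype σ]
    (e : D ≃L[ℝ] (σ → ℝ)) (f : SD D) : rhoSD e 0 0 f = f := by
  ext y
  rw [rhoSD_apply, rhoMul_zero_zero, one_mul, map_zero, add_zero]

/-- **equivariance of the slice for the first block's Heisenberg operators**:
`(ρ((p, 0), (q, 0)) Ψ)(·, a₂) = ρ(p, q) (Ψ(·, a₂))`. [cite: Folland1989, (1.25)] -/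
theorem sumSlice_rhoSD_elim_zero (a₂ : ι₂ → V) (p q : ι₁ × τ → ℝ) (Ψ : SD (ι₁ ⊕ ι₂ → V)) :
    sumSlice a₂ (rhoSD (sumCarrierEquiv b ι₁ ι₂) (Sum.elim p 0) (Sum.elim q 0) Ψ) =
      rhoSD (piCarrierEquiv b ι₁) p q (sumSlice a₂ Ψ) := by
  ext x₁
  rw [sumSlice_apply, rhoSD_apply, rhoSD_apply, sumSlice_apply, sumCarrierEquiv_elim, rhoMul_sum_elim,
    Sum.elim_comp_inl, Sum.elim_comp_inr, rhoMul_zero_zero, mul_one, sumCarrierEquiv_symm_elim, map_zero]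
  congr 2
  funext i
  rcases i with j | k <;> simp

end Slice

/-! ## §2  The projective two-factor Schur lemma for MAPS, on transported carriers -/

section SchurMaps

variable {σ₁ σ₂ : Type*} [Fintype σ₁] [Fintype σ₂] [DecidableEq σ₁] [DecidableEq σ₂]
variable {D₁ D₂ D : Type*} [NormedAddCommGroup D₁] [NormedSpace ℝ D₁] [NormedAddCommGroup D₂] [NormedSpace ℝ D₂]
  [NormedAddCommGroup D] [NormedSpace ℝ D]
variable (e₁ : D₁ ≃L[ℝ] (σ₁ → ℝ)) (e₂ : D₂ ≃L[ℝ] (σ₂ → ℝ)) (e : D ≃L[ℝ] (σ₁ ⊕ σ₂ → ℝ))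
variable {s₁ : (σ₁ → ℝ) × (σ₁ → ℝ) → (σ₁ → ℝ) × (σ₁ → ℝ)}
  {s₂ : (σ₂ → ℝ) × (σ₂ → ℝ) → (σ₂ → ℝ) × (σ₂ → ℝ)}
  {χ₁ : (σ₁ → ℝ) × (σ₁ → ℝ) → ℂ} {χ₂ : (σ₂ → ℝ) × (σ₂ → ℝ) → ℂ}

/-- **Projective two-factor Schur lemma, MAP form, on transported carriers.**  `M` a continuous automorphism of
`𝓢(D)` covariant over `blockPhase s₁ s₂` with cocycle `blockChar χ₁ χ₂` (`χ_j` nowhere zero), `A_j` continuous linear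
MAPS of `𝓢(D_j)` covariant over `(s_j, χ_j)`.  Then `A₁ f ⊠ A₂ g = c • M (f ⊠ g)` for one scalar `c` (possibly `0`)
and all `f, g`. [cite: Folland1989, Prop. (1.43)] -/
theorem exists_smul_of_tensor_covariant_projD (hχ₁ : ∀ v, χ₁ v ≠ 0) (hχ₂ : ∀ v, χ₂ v ≠ 0)
    (M : (SD D) ≃L[ℂ] SD D)
    (hM : ∀ (P Q : σ₁ ⊕ σ₂ → ℝ) (F : SD D), M (rhoSD e P Q F) =
      blockChar χ₁ χ₂ (P, Q) • rhoSD e (blockPhase s₁ s₂ (P, Q)).1 (blockPhase s₁ s₂ (P, Q)).2 (M F))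
    (A₁ : (SD D₁) →L[ℂ] SD D₁) (A₂ : (SD D₂) →L[ℂ] SD D₂)
    (hA₁ : ∀ (p q : σ₁ → ℝ) (f : SD D₁),
      A₁ (rhoSD e₁ p q f) = χ₁ (p, q) • rhoSD e₁ (s₁ (p, q)).1 (s₁ (p, q)).2 (A₁ f))
    (hA₂ : ∀ (p q : σ₂ → ℝ) (g : SD D₂),
      A₂ (rhoSD e₂ p q g) = χ₂ (p, q) • rhoSD e₂ (s₂ (p, q)).1 (s₂ (p, q)).2 (A₂ g)) :
    ∃ c : ℂ, ∀ (f : SD D₁) (g : SD D₂), tensorD e₁ e₂ e (A₁ f) (A₂ g) = c • M (tensorD e₁ e₂ e f g) := by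
  set M' : (SR (σ₁ ⊕ σ₂)) ≃L[ℂ] SR (σ₁ ⊕ σ₂) :=
    ((schwartzTransport e).symm.trans M).trans (schwartzTransport e) with hM'
  have hM'app : ∀ G, M' G = schwartzTransport e (M ((schwartzTransport e).symm G)) := fun G => rfl
  have hM'cov : ∀ (P Q : σ₁ ⊕ σ₂ → ℝ) (G : SR (σ₁ ⊕ σ₂)), M' (rhoS P Q G) =
      blockChar χ₁ χ₂ (P, Q) • rhoS (blockPhase s₁ s₂ (P, Q)).1 (blockPhase s₁ s₂ (P, Q)).2 (M' G) :=
    fun P Q G => by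
    rw [hM'app, hM'app, schwartzTransport_symm_rhoS, hM, map_smul, schwartzTransport_rhoSD]
  have hA₁' : ∀ (p q : σ₁ → ℝ) (f : SR σ₁),
      conjS e₁ A₁ (rhoS p q f) = χ₁ (p, q) • rhoS (s₁ (p, q)).1 (s₁ (p, q)).2 (conjS e₁ A₁ f) :=
    fun p q f => conjS_rhoS_proj e₁ A₁ hA₁ p q f
  have hA₂' : ∀ (p q : σ₂ → ℝ) (g : SR σ₂),
      conjS e₂ A₂ (rhoS p q g) = χ₂ (p, q) • rhoS (s₂ (p, q)).1 (s₂ (p, q)).2 (conjS e₂ A₂ g) :=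
    fun p q g => conjS_rhoS_proj e₂ A₂ hA₂ p q g
  set c := schurCoeff (((M'.symm : (SR (σ₁ ⊕ σ₂)) ≃L[ℂ] SR (σ₁ ⊕ σ₂)) :
      (SR (σ₁ ⊕ σ₂)) →L[ℂ] SR (σ₁ ⊕ σ₂)).comp (tensorOp (conjS e₁ A₁) (conjS e₂ A₂))) with hc
  refine ⟨c, fun f g => ?_⟩
  have h1 := eq_smul_of_tensor_covariant_proj hχ₁ hχ₂ M' hM'cov (conjS e₁ A₁) (conjS e₂ A₂) hA₁' hA₂'
    (tensorOp (conjS e₁ A₁) (conjS e₂ A₂)) (tensorOp_tensorPi _ _)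
    (tensorPi (schwartzTransport e₁ f) (schwartzTransport e₂ g))
  rw [tensorOp_tensorPi, conjS_apply, conjS_apply, ContinuousLinearEquiv.symm_apply_apply,
    ContinuousLinearEquiv.symm_apply_apply, ← hc, hM'app] at h1
  have h2 := congrArg (schwartzTransport e).symm h1
  rw [map_smul, ContinuousLinearEquiv.symm_apply_apply] at h2
  rw [tensorD, tensorD, h2]

end SchurMaps

/-! ## §3  Sum stripping: `M = A₁ ⊠̂ 1` when the second block is trivial -/

section SumStrip

variable {V : Type*} [NormedAddCommGroup V] [NormedSpace ℝ V] {τ : Type*} [Fintype τ] [DecidableEq τ]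
  (b : Module.Basis τ ℝ V)
variable {ι₁ ι₂ : Type*} [Fintype ι₁] [Fintype ι₂] [DecidableEq ι₁] [DecidableEq ι₂]
variable {s₁ : (ι₁ × τ → ℝ) × (ι₁ × τ → ℝ) → (ι₁ × τ → ℝ) × (ι₁ × τ → ℝ)}
  {s₂ : (ι₂ × τ → ℝ) × (ι₂ × τ → ℝ) → (ι₂ × τ → ℝ) × (ι₂ × τ → ℝ)}
  {χ₁ : (ι₁ × τ → ℝ) × (ι₁ × τ → ℝ) → ℂ} {χ₂ : (ι₂ × τ → ℝ) × (ι₂ × τ → ℝ) → ℂ}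

include b in
/-- `𝓢(ι → V) ≠ 0` (a transported Hermite function). [folklore] -/
private theorem exists_schwartzMap_ne_zero (ι : Type*) [Fintype ι] [DecidableEq ι] : ∃ f : SD (ι → V), f ≠ 0 := by
  classical
  refine ⟨(schwartzTransport (piCarrierEquiv b ι)).symm (hermitePi 0), fun h => ?_⟩
  exact hermitePi_ne_zero (0 : ι × τ →₀ ℕ) (((schwartzTransport (piCarrierEquiv b ι)).symm.map_eq_zero_iff).1 h)

omit [Fintype τ] [DecidableEq τ] [DecidableEq ι₁] [DecidableEq ι₂] in
/-- a non-zero Schwartz function has a non-zero value. [folklore] -/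
private theorem exists_apply_ne_zero_of_ne_zero {D : Type*} [NormedAddCommGroup D] [NormedSpace ℝ D] {f : SD D}
    (hf : f ≠ 0) : ∃ x, f x ≠ 0 := by
  by_contra h
  push Not at h
  exact hf (SchwartzMap.ext h)

omit [Fintype τ] [DecidableEq τ] [DecidableEq ι₁] [DecidableEq ι₂] in
/-- `f ⊠ g ≠ 0` for `f, g ≠ 0` (the product of Schwartz functions in separate variables). [cite: Folland1989, §1.7] -/
theorem piBoxTensor_ne_zero {f : SD (ι₁ → V)} {g : SD (ι₂ → V)} (hf : f ≠ 0) (hg : g ≠ 0) :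
    piBoxTensor f g ≠ 0 := by
  obtain ⟨x₁, hx₁⟩ := exists_apply_ne_zero_of_ne_zero hf
  obtain ⟨x₂, hx₂⟩ := exists_apply_ne_zero_of_ne_zero hg
  intro h
  have h1 := congrArg (fun F : SD (ι₁ ⊕ ι₂ → V) => F (Sum.elim x₁ x₂)) h
  simp only [piBoxTensor_apply, Sum.elim_comp_inl, Sum.elim_comp_inr, zero_apply] at h1
  exact mul_ne_zero hx₁ hx₂ h1

omit [Fintype τ] [DecidableEq τ] [DecidableEq ι₁] [DecidableEq ι₂] in
/-- `(c • f) ⊠ g = c • (f ⊠ g)` (bilinearity of the separate-variables product). [cite: Folland1989, §1.7] -/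
theorem piBoxTensor_smul_left (c : ℂ) (f : SD (ι₁ → V)) (g : SD (ι₂ → V)) :
    piBoxTensor (c • f) g = c • piBoxTensor f g := by
  ext x
  simp [mul_assoc]

include b in
/-- **SUM STRIPPING.**  Let `M` be a continuous linear automorphism of `𝓢((ι₁ ⊕ ι₂) → V)`, projectively covariant
over the block phase-space map `blockPhase s₁ s₂` with cocycle `blockChar χ₁ χ₂`, where `χ₁` vanishes nowhere and the
SECOND BLOCK IS TRIVIAL (`s₂ = id`, `χ₂ = 1`).  Then there is a continuous linear automorphism `A₁` of `𝓢(ι₁ → V)`,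
covariant over `(s₁, χ₁)`, with `M (f ⊠ g) = A₁ f ⊠ g` for all `f`, `g`.
[cite: Folland1989, Prop. (1.43); Weil1964, Chap. III n° 38] -/
theorem exists_sumStrip (hχ₁ : ∀ v, χ₁ v ≠ 0) (hs₂ : ∀ v, s₂ v = v) (hχ₂ : ∀ v, χ₂ v = 1)
    (M : (SD (ι₁ ⊕ ι₂ → V)) ≃L[ℂ] SD (ι₁ ⊕ ι₂ → V))
    (hM : ∀ (P Q : (ι₁ × τ) ⊕ (ι₂ × τ) → ℝ) (F : SD (ι₁ ⊕ ι₂ → V)),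
      M (rhoSD (sumCarrierEquiv b ι₁ ι₂) P Q F) =
        blockChar χ₁ χ₂ (P, Q) • rhoSD (sumCarrierEquiv b ι₁ ι₂) (blockPhase s₁ s₂ (P, Q)).1
          (blockPhase s₁ s₂ (P, Q)).2 (M F)) :
    ∃ A₁ : (SD (ι₁ → V)) ≃L[ℂ] SD (ι₁ → V),
      (∀ (f : SD (ι₁ → V)) (g : SD (ι₂ → V)), M (piBoxTensor f g) = piBoxTensor (A₁ f) g) ∧
        ∀ (p q : ι₁ × τ → ℝ) (f : SD (ι₁ → V)), A₁ (rhoSD (piCarrierEquiv b ι₁) p q f) =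
          χ₁ (p, q) • rhoSD (piCarrierEquiv b ι₁) (s₁ (p, q)).1 (s₁ (p, q)).2 (A₁ f) := by
  classical
  -- non-zero test functions and a point where `M (f₀ ⊠ g₀)` does not vanish
  obtain ⟨f₀, hf₀⟩ := exists_schwartzMap_ne_zero b ι₁
  obtain ⟨g₀, hg₀⟩ := exists_schwartzMap_ne_zero b ι₂
  have hMfg : M (piBoxTensor f₀ g₀) ≠ 0 := fun h =>
    piBoxTensor_ne_zero hf₀ hg₀ ((M.map_eq_zero_iff).1 h)
  obtain ⟨v, hv⟩ := exists_apply_ne_zero_of_ne_zero hMfg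
  obtain ⟨x₂, hx₂⟩ := exists_apply_ne_zero_of_ne_zero hg₀
  set a₂ : ι₂ → V := v ∘ Sum.inr with ha₂
  set e₁ := piCarrierEquiv b ι₁ with he₁
  set e₂ := piCarrierEquiv b ι₂ with he₂
  set e := sumCarrierEquiv b ι₁ ι₂ with he
  -- `R f = f ⊠ g₀`
  set R : (SD (ι₁ → V)) →L[ℂ] SD (ι₁ ⊕ ι₂ → V) := SchwartzMap.sumProdLeftCLM g₀ with hR
  have hRapp : ∀ f, R f = piBoxTensor f g₀ := fun f => sumProdLeftCLM_apply_eq_piBoxTensor g₀ f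
  -- the raw slice `A₀ f = (M (f ⊠ g₀))(·, a₂)`
  set A₀ : (SD (ι₁ → V)) →L[ℂ] SD (ι₁ → V) :=
    (sumSlice a₂).comp ((M : (SD (ι₁ ⊕ ι₂ → V)) →L[ℂ] SD (ι₁ ⊕ ι₂ → V)).comp R) with hA₀
  have hA₀app : ∀ f, A₀ f = sumSlice a₂ (M (piBoxTensor f g₀)) := fun f => by
    rw [hA₀, ContinuousLinearMap.comp_apply, ContinuousLinearMap.comp_apply, hRapp]; rfl
  have hA₀f₀ : A₀ f₀ ≠ 0 := by
    intro h
    have h1 := congrArg (fun F : SD (ι₁ → V) => F (v ∘ Sum.inl)) h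
    simp only [hA₀app, sumSlice_apply, zero_apply] at h1
    rw [ha₂, Sum.elim_comp_inl_inr] at h1
    exact hv h1
  -- `ρ(0,0) = 1` on the second block and the Heisenberg operators of the first block on products
  have hbox : ∀ (p q : ι₁ × τ → ℝ) (f : SD (ι₁ → V)) (g : SD (ι₂ → V)),
      piBoxTensor (rhoSD e₁ p q f) g = rhoSD e (Sum.elim p 0) (Sum.elim q 0) (piBoxTensor f g) := by
    intro p q f g
    rw [piBoxTensor_eq_tensorD b, piBoxTensor_eq_tensorD b, rhoSD_tensorD, rhoSD_zero_zero_apply]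
  -- covariance of the raw slice
  have hA₀cov : ∀ (p q : ι₁ × τ → ℝ) (f : SD (ι₁ → V)),
      A₀ (rhoSD e₁ p q f) = χ₁ (p, q) • rhoSD e₁ (s₁ (p, q)).1 (s₁ (p, q)).2 (A₀ f) := by
    intro p q f
    rw [hA₀app, hA₀app, hbox, hM, blockChar_elim, blockPhase_elim, hχ₂, mul_one, hs₂, map_smul]
    change χ₁ (p, q) • sumSlice a₂ (rhoSD e (Sum.elim (s₁ (p, q)).1 (0 : ι₂ × τ → ℝ))
      (Sum.elim (s₁ (p, q)).2 (0 : ι₂ × τ → ℝ)) (M (piBoxTensor f g₀))) = _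
    rw [sumSlice_rhoSD_elim_zero]
  have hIdcov : ∀ (p q : ι₂ × τ → ℝ) (g : SD (ι₂ → V)),
      (ContinuousLinearMap.id ℂ (SD (ι₂ → V))) (rhoSD e₂ p q g) =
        χ₂ (p, q) • rhoSD e₂ (s₂ (p, q)).1 (s₂ (p, q)).2 ((ContinuousLinearMap.id ℂ (SD (ι₂ → V))) g) := by
    intro p q g
    rw [hχ₂, hs₂, one_smul, ContinuousLinearMap.id_apply, ContinuousLinearMap.id_apply]
  -- the projective Schur lemma, map form
  obtain ⟨c, hc⟩ := exists_smul_of_tensor_covariant_projD e₁ e₂ e hχ₁ (fun v => by rw [hχ₂]; exact one_ne_zero)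
    M hM A₀ (ContinuousLinearMap.id ℂ (SD (ι₂ → V))) hA₀cov hIdcov
  have hc' : ∀ (f : SD (ι₁ → V)) (g : SD (ι₂ → V)), piBoxTensor (A₀ f) g = c • M (piBoxTensor f g) := by
    intro f g
    have h := hc f g
    rwa [ContinuousLinearMap.id_apply, ← piBoxTensor_eq_tensorD b, ← piBoxTensor_eq_tensorD b] at h
  have hc0 : c ≠ 0 := by
    intro h0
    have h := hc' f₀ g₀
    rw [h0, zero_smul] at h
    exact piBoxTensor_ne_zero hA₀f₀ hg₀ h
  -- the normalised slice
  set A₁ : (SD (ι₁ → V)) →L[ℂ] SD (ι₁ → V) := c⁻¹ • A₀ with hA₁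
  have hMbox : ∀ (f : SD (ι₁ → V)) (g : SD (ι₂ → V)), M (piBoxTensor f g) = piBoxTensor (A₁ f) g := by
    intro f g
    rw [show A₁ f = c⁻¹ • A₀ f from rfl, piBoxTensor_smul_left, hc', smul_smul, inv_mul_cancel₀ hc0, one_smul]
  -- `M = A₁ ⊠̂ 1`, hence the slices of `M` are `A₁ ∘ slice`
  have hMop : (M : (SD (ι₁ ⊕ ι₂ → V)) →L[ℂ] SD (ι₁ ⊕ ι₂ → V)) =
      tensorOpD e₁ e₂ e A₁ (ContinuousLinearMap.id ℂ (SD (ι₂ → V))) :=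
    eq_tensorOpD_of_apply_tensorD e₁ e₂ e fun f g => by
      rw [ContinuousLinearEquiv.coe_coe, ← piBoxTensor_eq_tensorD b, ← piBoxTensor_eq_tensorD b, hMbox,
        ContinuousLinearMap.id_apply]
  have hsliceM : ∀ (a : ι₂ → V), (sumSlice a).comp (M : (SD (ι₁ ⊕ ι₂ → V)) →L[ℂ] SD (ι₁ ⊕ ι₂ → V)) =
      A₁.comp (sumSlice a) := by
    intro a
    refine clm_eq_of_eq_on_tensorD e₁ e₂ e fun f g => ?_
    rw [ContinuousLinearMap.comp_apply, ContinuousLinearMap.comp_apply, ContinuousLinearEquiv.coe_coe,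
      ← piBoxTensor_eq_tensorD b, hMbox, sumSlice_piBoxTensor, sumSlice_piBoxTensor, map_smul]
  -- the inverse: a slice of `M⁻¹`
  set B : (SD (ι₁ → V)) →L[ℂ] SD (ι₁ → V) :=
    (sumSlice x₂).comp ((M.symm : (SD (ι₁ ⊕ ι₂ → V)) →L[ℂ] SD (ι₁ ⊕ ι₂ → V)).comp R) with hB
  have hBapp : ∀ F, B F = sumSlice x₂ (M.symm (piBoxTensor F g₀)) := fun F => by
    rw [hB, ContinuousLinearMap.comp_apply, ContinuousLinearMap.comp_apply, hRapp]; rfl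
  have hBA : ∀ f, B (A₁ f) = g₀ x₂ • f := fun f => by
    rw [hBapp, ← hMbox, ContinuousLinearEquiv.symm_apply_apply, sumSlice_piBoxTensor]
  have hAB : ∀ F, A₁ (B F) = g₀ x₂ • F := fun F => by
    have h := congrArg (fun T : (SD (ι₁ ⊕ ι₂ → V)) →L[ℂ] SD (ι₁ → V) => T (M.symm (piBoxTensor F g₀))) (hsliceM x₂)
    simp only [ContinuousLinearMap.comp_apply, ContinuousLinearEquiv.coe_coe,
      ContinuousLinearEquiv.apply_symm_apply, sumSlice_piBoxTensor] at h
    rw [hBapp, ← h]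
  set A₁e : (SD (ι₁ → V)) ≃L[ℂ] SD (ι₁ → V) :=
    ContinuousLinearEquiv.equivOfInverse A₁ ((g₀ x₂)⁻¹ • B)
      (fun f => by
        change (g₀ x₂)⁻¹ • B (A₁ f) = f
        rw [hBA, smul_smul, inv_mul_cancel₀ hx₂, one_smul])
      (fun F => by
        change A₁ ((g₀ x₂)⁻¹ • B F) = F
        rw [map_smul, hAB, smul_smul, inv_mul_cancel₀ hx₂, one_smul]) with hA₁e
  have hA₁e_app : ∀ f, A₁e f = A₁ f := fun f => rfl
  refine ⟨A₁e, fun f g => by rw [hA₁e_app, hMbox], fun p q f => ?_⟩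
  rw [hA₁e_app, hA₁e_app]
  change c⁻¹ • A₀ (rhoSD e₁ p q f) = χ₁ (p, q) • rhoSD e₁ (s₁ (p, q)).1 (s₁ (p, q)).2 (c⁻¹ • A₀ f)
  rw [hA₀cov, map_smul, smul_comm]

end SumStrip

end Literature.Analysis.SegalBargmann

end
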